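import Summits.Schanuel.Schanuel.Theorems.RootDecomp1HCurveHull

/-!
# RootDecomp1H / 1J — BLOCK CLEARANCE: a counterexample off a `j`-absorbing Schanuel subspace meets it in codimension `≥ j + 2`
# (round 7 of route-Schanuel-RootDecomp1H, addendum; the abstract form of `RootDecomp1HClearance.clearance`)

Let `K ≤ ℂ` be a `ℚ`-subspace which
* satisfies Schanuel on its own tuples (`SchanuelOn K`, file `RootDecomp1HCurveHullMerge`), and
* ABSORBS BLOCKS of size `≤ j` (`AbsorbsBlocks j K`): whenever `w₁, …, w_i` (`i ≤ j`) have joint relative depth `≤ i` over the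
  field `ℚ(v, e^v)` of a finite tuple `v ⊆ K` — `trdeg ℚ(v, w, e^v, e^w) ≤ trdeg ℚ(v, e^v) + i` — all `w_l` lie in `K`.

**`block_clearance`.**  If `1 ≤ j`, every counterexample `y ∈ ℂⁿ` to Schanuel's conjecture (`ℚ`-free, `trdeg ℚ(y, e^y) < n`) NOT
contained in `K` satisfies `dim_ℚ (span_ℚ y ∩ K) + j + 2 ≤ n`.  The proof is a one-block test (no tower bookkeeping, no lower-rank
hypothesis): complete a basis `u` of `span y ∩ K` by `i₀ = min(k, j)` coordinates of `y`; either the block is absorbed (recurse) or it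
has relative depth `≥ i₀ + 1`, and then `trdeg ℚ(y, e^y) ≥ dim + i₀ + 1 ≥ n` — impossible.  Consequences: Schanuel holds outright in
all ranks `≤ j + 1` (`schanuelRank_of_absorbsBlocks`); for `j = 1` and 1J's curve hull `𝓚` (curve-closed by construction,
`isCurveClosed_curveHull`) this is CLEARANCE `3` from `𝓚` under Schanuel-on-`𝓚` alone (`finrank_inf_curveHull_add_three_le`) — the
lower-rank hypothesis of `RootDecomp1HClearance.finrank_inf_curveHull_add_three_le` is not needed; for `j = 2` it is the typed target
offered to route 1J's `K₂`: an `AbsorbsBlocks 2 K₂` certificate plus Schanuel on `K₂` puts every remaining counterexample at clearance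
`4` from `K₂` (`finrank_inf_add_four_le_of_absorbsBlocks_two`).

Lens-5 cell decomp-schanuel, generation 7, addendum to node `Clearance.lean`.  0 sorry; axioms standard.
-/

set_option linter.dupNamespace false

namespace Summit.Schanuel.Schanuel.Theorems.RootDecomp1HBlockClearance

open Complex Set
open Literature.NumberTheory.Transcendental
open Summit.Schanuel.Schanuel.Theses.RootDecomp1H
open Summit.Schanuel.Schanuel.Theorems.RootDecomp1HTowerCells
open Summit.Schanuel.Schanuel.Theorems.RootDecomp1HProductCells
open Summit.Schanuel.Schanuel.Theorems.RootDecomp1HHull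
open Summit.Schanuel.Schanuel.Theorems.RootDecomp1HCurveHull

/-! ## 1. Block absorption -/

/-- `K` ABSORBS BLOCKS OF SIZE `≤ j`: for every `ℚ`-FREE tuple `c = (v, w)` of length `m + i`, `i ≤ j`, whose prefix `v` lies in
`K` and whose suffix block `w` has joint relative depth `≤ i` over `ℚ(v, e^v)` (stated absolutely: `trdeg ℚ(c, e^c) ≤
trdeg ℚ(v, e^v) + i`), the block lies in `K`.  Freeness of `c` is essential for `j ≥ 2` (the dependent block `(w, w)` has depth
`≤ 2` over anything, so without it only `K = ℂ` would absorb `2`-blocks); for `j = 1` the condition is implied by 1J's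
curve-closedness (`absorbsBlocks_one_of_isCurveClosed`).  Heuristically (Ax–Schanuel) the free blocks of depth `≤ i` over a
finite `v` form a countable set, so the least `j`-absorbing subspace is countable-dimensional, like 1J's hulls. -/
def AbsorbsBlocks (j : ℕ) (K : Submodule ℚ ℂ) : Prop :=
  ∀ (m i : ℕ), i ≤ j → ∀ (c : Fin (m + i) → ℂ), LinearIndependent ℚ c → (∀ l : Fin m, c (Fin.castAdd i l) ∈ K) →
    Algebra.trdeg ℚ ↥(IntermediateField.adjoin ℚ (range c ∪ range (cexp ∘ c))) ≤
      Algebra.trdeg ℚ ↥(IntermediateField.adjoin ℚ (range (c ∘ Fin.castAdd i) ∪ range (cexp ∘ (c ∘ Fin.castAdd i)))) +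
        (i : Cardinal) →
    ∀ l : Fin i, c (Fin.natAdd m l) ∈ K

/-- The field of a finite tuple and its exponentials has finite transcendence degree. -/
theorem trdeg_pairRange_lt_aleph0 {q : ℕ} (f : Fin q → ℂ) :
    Algebra.trdeg ℚ ↥(IntermediateField.adjoin ℚ (range f ∪ range (cexp ∘ f))) < Cardinal.aleph0 :=
  lt_of_le_of_lt ((trdeg_adjoin_union_le _ _).trans
      (add_le_add (trdeg_adjoin_range_le (F := ℚ) (E := ℂ) f) (trdeg_adjoin_range_le (F := ℚ) (E := ℂ) (cexp ∘ f))))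
    (Cardinal.add_lt_aleph0 (Cardinal.natCast_lt_aleph0) (Cardinal.natCast_lt_aleph0))

/-! ## 2. Completing a free family inside `span y` by coordinates of `y` -/

/-- A `ℚ`-free family `v` of `m` vectors (`y` free of rank `n`) extends, for every `i ≤ n - m`, to a free family `c = (v, w)` of
length `m + i` whose new entries are COORDINATES of `y`. -/
theorem exists_li_extension {n : ℕ} {y : Fin n → ℂ} (hy : LinearIndependent ℚ y) {m : ℕ} {v : Fin m → ℂ}
    (hv : LinearIndependent ℚ v) :
    ∀ (i : ℕ), m + i ≤ n → ∃ c : Fin (m + i) → ℂ, LinearIndependent ℚ c ∧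
      (∀ l : Fin m, c (Fin.castAdd i l) = v l) ∧ ∀ l : Fin i, c (Fin.natAdd m l) ∈ range y := by
  classical
  intro i
  induction i with
  | zero =>
    intro _
    exact ⟨v, hv, fun l => congrArg v (Fin.ext rfl), fun l => l.elim0⟩
  | succ i ih =>
    intro hi
    obtain ⟨c, hc, hcv, hcy⟩ := ih (by omega)
    haveI := FiniteDimensional.span_of_finite ℚ (Set.finite_range y)
    haveI := FiniteDimensional.span_of_finite ℚ (Set.finite_range c)
    have hex : ∃ t, y t ∉ Submodule.span ℚ (range c) := by
      by_contra hall
      push Not at hall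
      have hle : Submodule.span ℚ (range y) ≤ Submodule.span ℚ (range c) :=
        Submodule.span_le.2 (by rintro _ ⟨t, rfl⟩; exact hall t)
      have h1 := finrank_span_eq_card hy
      have h2 := finrank_span_eq_card hc
      have h3 := Submodule.finrank_mono hle
      simp only [Fintype.card_fin] at h1 h2
      omega
    obtain ⟨t, ht⟩ := hex
    refine ⟨Fin.snoc c (y t), linearIndependent_finSnoc.2 ⟨hc, ht⟩, fun l => ?_, fun l => ?_⟩
    · have h : (Fin.castAdd (i + 1) l : Fin (m + i + 1)) = Fin.castSucc (Fin.castAdd i l) := Fin.ext rfl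
      rw [h, Fin.snoc_castSucc]
      exact hcv l
    · refine Fin.lastCases ?_ (fun l' => ?_) l
      · show (Fin.snoc c (y t) : Fin (m + i + 1) → ℂ) (Fin.last (m + i)) ∈ range y
        rw [Fin.snoc_last]
        exact ⟨t, rfl⟩
      · have h : (Fin.natAdd m (Fin.castSucc l') : Fin (m + i + 1)) = Fin.castSucc (Fin.natAdd m l') := Fin.ext rfl
        rw [h, Fin.snoc_castSucc]
        exact hcy l'

/-! ## 3. The block clearance theorem -/

/-- **BLOCK CLEARANCE.**  `K` a `ℚ`-subspace with Schanuel on `K` and absorbing blocks of size `≤ j` (`1 ≤ j`); `y` a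
counterexample of rank `n` not contained in `K`; `u` any `ℚ`-free family of `m` vectors in `span_ℚ y ∩ K`.  Then `m + j + 2 ≤ n`. -/
theorem block_clearance {j : ℕ} (hj : 1 ≤ j) {K : Submodule ℚ ℂ} (hS : SchanuelOn K) (hK : AbsorbsBlocks j K)
    {n : ℕ} {y : Fin n → ℂ} (hy : LinearIndependent ℚ y)
    (hdef : Algebra.trdeg ℚ ↥(IntermediateField.adjoin ℚ (range y ∪ range (cexp ∘ y))) < (n : Cardinal))
    (hyK : ¬ ∀ t, y t ∈ K) {m : ℕ} {u : Fin m → ℂ} (hu : LinearIndependent ℚ u)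
    (huy : ∀ l, u l ∈ Submodule.span ℚ (range y)) (huK : ∀ l, u l ∈ K) : m + (j + 2) ≤ n := by
  classical
  haveI := FiniteDimensional.span_of_finite ℚ (Set.finite_range y)
  -- strong induction on the co-dimension `k = n - m`
  suffices h : ∀ (k m : ℕ), m + k = n → ∀ (u : Fin m → ℂ), LinearIndependent ℚ u →
      (∀ l, u l ∈ Submodule.span ℚ (range y)) → (∀ l, u l ∈ K) → m + (j + 2) ≤ n by
    have hmn : m ≤ n := by
      have h1 := finrank_span_eq_card hu
      have h2 := finrank_span_eq_card hy
      have h3 := Submodule.finrank_mono (Submodule.span_le.2 (Set.range_subset_iff.2 huy))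
      simp only [Fintype.card_fin] at h1 h2
      omega
    exact h (n - m) m (by omega) u hu huy huK
  intro k
  induction k using Nat.strong_induction_on with
  | h k ih =>
  intro m hm u hu huy huK
  by_cases hk : j + 2 ≤ k
  · omega
  exfalso
  rcases Nat.eq_zero_or_pos k with hk0 | hkpos
  · -- `k = 0`: `span u = span y`, so `y ⊆ K`
    subst hk0
    haveI := FiniteDimensional.span_of_finite ℚ (Set.finite_range u)
    have hle : Submodule.span ℚ (range u) ≤ Submodule.span ℚ (range y) :=
      Submodule.span_le.2 (Set.range_subset_iff.2 huy)
    have heq : Submodule.span ℚ (range u) = Submodule.span ℚ (range y) :=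
      Submodule.eq_of_le_of_finrank_eq hle (by
        rw [finrank_span_eq_card hu, finrank_span_eq_card hy]
        simp only [Fintype.card_fin]
        omega)
    refine hyK fun t => ?_
    have ht : y t ∈ Submodule.span ℚ (range u) := heq ▸ Submodule.subset_span ⟨t, rfl⟩
    exact (Submodule.span_le.2 (Set.range_subset_iff.2 huK)) ht
  · -- `1 ≤ k ≤ j + 1`: test the block of size `i₀ = min k j`
    set i₀ : ℕ := min k j with hi₀
    have hi₀j : i₀ ≤ j := min_le_right _ _
    have hi₀pos : 1 ≤ i₀ := le_min hkpos hj
    -- scale `u` into `span_ℤ y`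
    choose N₁ hN₁ hN₁_mem using fun l => Literature.NumberTheory.Transcendental.exists_nsmul_mem_span_int y (huy l)
    let q : Fin m → ℚ := fun l => (N₁ l : ℚ)
    have hq : ∀ l, q l ≠ 0 := fun l => Nat.cast_ne_zero.2 (hN₁ l)
    let u' : Fin m → ℂ := fun l => q l • u l
    have hu'li : LinearIndependent ℚ u' := linearIndependent_smul hu q hq
    have hu'Z : ∀ l, u' l ∈ Submodule.span ℤ (range y) := fun l => hN₁_mem l
    have hu'y : ∀ l, u' l ∈ Submodule.span ℚ (range y) := fun l => Submodule.smul_mem _ _ (huy l)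
    have hu'K : ∀ l, u' l ∈ K := fun l => K.smul_mem _ (huK l)
    -- complete `u'` by `i₀` coordinates of `y` to a free family `c`
    obtain ⟨c, hc, hcu, hcy⟩ := exists_li_extension hy hu'li i₀ (by omega)
    have hcZ : ∀ l, c l ∈ Submodule.span ℤ (range y) := by
      intro l
      induction l using Fin.addCases with
      | left l₁ => rw [hcu]; exact hu'Z l₁
      | right l₂ =>
        obtain ⟨t, ht⟩ := hcy l₂
        rw [← ht]
        exact Submodule.subset_span ⟨t, rfl⟩
    have hcy' : ∀ l, c l ∈ Submodule.span ℚ (range y) := by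
      intro l
      induction l using Fin.addCases with
      | left l₁ => rw [hcu]; exact hu'y l₁
      | right l₂ =>
        obtain ⟨t, ht⟩ := hcy l₂
        rw [← ht]
        exact Submodule.subset_span ⟨t, rfl⟩
    have hcK_left : ∀ l : Fin m, c (Fin.castAdd i₀ l) ∈ K := fun l => by rw [hcu]; exact hu'K l
    -- the field of `c` sits inside `ℚ(y, e^y)`
    have hle : IntermediateField.adjoin ℚ (range c ∪ range (cexp ∘ c)) ≤
        IntermediateField.adjoin ℚ (range y ∪ range (cexp ∘ y)) := by
      rw [IntermediateField.adjoin_le_iff]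
      rintro a (⟨l, rfl⟩ | ⟨l, rfl⟩)
      · exact (Literature.NumberTheory.Transcendental.mem_adjoin_of_mem_span_int y (hcZ l)).1
      · exact (Literature.NumberTheory.Transcendental.mem_adjoin_of_mem_span_int y (hcZ l)).2
    have hcy_trdeg := trdeg_le_of_injective (IntermediateField.inclusion hle) (IntermediateField.inclusion_injective hle)
    -- Schanuel on `K` for the prefix `u' = c ∘ castAdd`
    have hprefix : (c ∘ Fin.castAdd i₀) = u' := funext hcu
    have hm_le : (m : Cardinal) ≤ Algebra.trdeg ℚ ↥(IntermediateField.adjoin ℚ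
        (range (c ∘ Fin.castAdd i₀) ∪ range (cexp ∘ (c ∘ Fin.castAdd i₀)))) := by
      rw [hprefix]
      exact hS m u' hu'K hu'li
    by_cases habs : Algebra.trdeg ℚ ↥(IntermediateField.adjoin ℚ (range c ∪ range (cexp ∘ c))) ≤
        Algebra.trdeg ℚ ↥(IntermediateField.adjoin ℚ
          (range (c ∘ Fin.castAdd i₀) ∪ range (cexp ∘ (c ∘ Fin.castAdd i₀)))) + (i₀ : Cardinal)
    · -- absorbed: the block joins `K`; recurse with `c`
      have hblock := hK m i₀ hi₀j c hc hcK_left habs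
      have hcK : ∀ l, c l ∈ K := by
        intro l
        induction l using Fin.addCases with
        | left l₁ => exact hcK_left l₁
        | right l₂ => exact hblock l₂
      have h := ih (k - i₀) (by omega) (m + i₀) (by omega) c hc hcy' hcK
      omega
    · -- not absorbed: `m + i₀ + 1 ≤ trdeg ℚ(c, e^c) ≤ trdeg ℚ(y, e^y) ≤ n - 1`
      push Not at habs
      obtain ⟨t, ht⟩ := Cardinal.lt_aleph0.mp ((hcy_trdeg.trans_lt hdef).trans (Cardinal.natCast_lt_aleph0 (n := n)))
      have h1 : (m : Cardinal) + (i₀ : Cardinal) < (t : Cardinal) :=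
        ((add_le_add hm_le le_rfl).trans_lt habs).trans_eq ht
      have h2 : (t : Cardinal) < (n : Cardinal) := ht.ge.trans_lt (hcy_trdeg.trans_lt hdef)
      norm_cast at h1 h2
      omega

/-- **BLOCK CLEARANCE, finrank form**: `finrank_ℚ (span_ℚ y ⊓ K) + j + 2 ≤ n`. -/
theorem finrank_inf_add_le_of_absorbsBlocks {j : ℕ} (hj : 1 ≤ j) {K : Submodule ℚ ℂ} (hS : SchanuelOn K)
    (hK : AbsorbsBlocks j K) {n : ℕ} {y : Fin n → ℂ} (hy : LinearIndependent ℚ y)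
    (hdef : Algebra.trdeg ℚ ↥(IntermediateField.adjoin ℚ (range y ∪ range (cexp ∘ y))) < (n : Cardinal))
    (hyK : ¬ ∀ t, y t ∈ K) : Module.finrank ℚ ↥(Submodule.span ℚ (range y) ⊓ K) + (j + 2) ≤ n := by
  classical
  haveI := FiniteDimensional.span_of_finite ℚ (Set.finite_range y)
  set U : Submodule ℚ ℂ := Submodule.span ℚ (range y) ⊓ K with hU
  haveI : FiniteDimensional ℚ ↥U := Submodule.finiteDimensional_of_le inf_le_left
  let bU := Module.finBasis ℚ ↥U
  let u : Fin (Module.finrank ℚ ↥U) → ℂ := fun i => (bU i : ℂ)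
  have hu : LinearIndependent ℚ u := bU.linearIndependent.map' U.subtype (Submodule.ker_subtype U)
  have hmem : ∀ i, u i ∈ U := fun i => (bU i).2
  exact block_clearance hj hS hK hy hdef hyK hu (fun i => (Submodule.mem_inf.1 (hmem i)).1)
    fun i => (Submodule.mem_inf.1 (hmem i)).2

/-- **SMALL RANKS ARE SWALLOWED**: a counterexample of rank `≤ j + 1` lies inside `K` … -/
theorem mem_of_counterEx_rank_le {j : ℕ} (hj : 1 ≤ j) {K : Submodule ℚ ℂ} (hS : SchanuelOn K) (hK : AbsorbsBlocks j K)
    {n : ℕ} (hn : n ≤ j + 1) {y : Fin n → ℂ} (hy : LinearIndependent ℚ y)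
    (hdef : Algebra.trdeg ℚ ↥(IntermediateField.adjoin ℚ (range y ∪ range (cexp ∘ y))) < (n : Cardinal)) :
    ∀ t, y t ∈ K := by
  by_contra hyK
  have h := finrank_inf_add_le_of_absorbsBlocks hj hS hK hy hdef hyK
  omega

/-- … hence **Schanuel holds outright in every rank `≤ j + 1`** as soon as it holds on a `j`-absorbing subspace. -/
theorem schanuelRank_of_absorbsBlocks {j : ℕ} (hj : 1 ≤ j) {K : Submodule ℚ ℂ} (hS : SchanuelOn K)
    (hK : AbsorbsBlocks j K) {n : ℕ} (hn : n ≤ j + 1) : SchanuelRank n := by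
  intro y hy
  by_contra hlt
  push Not at hlt
  exact absurd (hS n y (mem_of_counterEx_rank_le hj hS hK hn hy hlt) hy) (not_le.2 hlt)

/-! ## 4. `j = 1`: curve-closed subspaces, 1J's curve hull `𝓚` -/

/-- A CURVE-CLOSED subspace absorbs blocks of size `1` (even dependent ones: freeness is not used). -/
theorem absorbsBlocks_one_of_isCurveClosed {K : Submodule ℚ ℂ} (hK : IsCurveClosed K) : AbsorbsBlocks 1 K := by
  classical
  intro m i hi c _ hcK habs l
  obtain rfl | rfl : i = 0 ∨ i = 1 := by omega
  · exact l.elim0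
  · obtain rfl : l = 0 := Subsingleton.elim _ _
    set Y : Finset ℂ := Finset.univ.image (c ∘ Fin.castAdd 1) with hYdef
    have hY : (↑Y : Set ℂ) ⊆ ↑K := by
      intro z hz
      obtain ⟨l₁, -, rfl⟩ := Finset.mem_image.mp (Finset.mem_coe.mp hz)
      exact hcK l₁
    refine mem_of_isCurveClosed hK hY ?_
    have hYset : (↑Y : Set ℂ) ∪ cexp '' ↑Y = range (c ∘ Fin.castAdd 1) ∪ range (cexp ∘ (c ∘ Fin.castAdd 1)) := by
      have h1 : (↑Y : Set ℂ) = range (c ∘ Fin.castAdd 1) := by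
        rw [hYdef, Finset.coe_image, Finset.coe_univ, Set.image_univ]
      rw [h1, ← Set.range_comp]
    rw [curveCond_iff_of_eq hYset]
    have hset : range c ∪ range (cexp ∘ c) = (range (c ∘ Fin.castAdd 1) ∪ range (cexp ∘ (c ∘ Fin.castAdd 1))) ∪
        ({c (Fin.natAdd m 0), cexp (c (Fin.natAdd m 0))} : Set ℂ) := by
      ext z
      constructor
      · rintro (⟨l, rfl⟩ | ⟨l, rfl⟩)
        · induction l using Fin.addCases with
          | left l₁ => exact Or.inl (Or.inl ⟨l₁, rfl⟩)
          | right l₂ =>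
            obtain rfl : l₂ = 0 := Subsingleton.elim _ _
            exact Or.inr (Or.inl rfl)
        · induction l using Fin.addCases with
          | left l₁ => exact Or.inl (Or.inr ⟨l₁, rfl⟩)
          | right l₂ =>
            obtain rfl : l₂ = 0 := Subsingleton.elim _ _
            exact Or.inr (Or.inr rfl)
      · rintro ((⟨l₁, rfl⟩ | ⟨l₁, rfl⟩) | rfl | hz)
        · exact Or.inl ⟨_, rfl⟩
        · exact Or.inr ⟨_, rfl⟩
        · exact Or.inl ⟨_, rfl⟩
        · rw [Set.mem_singleton_iff.1 hz]
          exact Or.inr ⟨Fin.natAdd m 0, rfl⟩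
    have htower := trdeg_adjoin_adjoin_eq (K := ℚ) (E := ℂ)
      (range (c ∘ Fin.castAdd 1) ∪ range (cexp ∘ (c ∘ Fin.castAdd 1)))
      ({c (Fin.natAdd m 0), cexp (c (Fin.natAdd m 0))} : Set ℂ)
    rw [← hset] at htower
    have hfin := trdeg_pairRange_lt_aleph0 (c ∘ Fin.castAdd 1)
    -- `trdegP + rel = trdeg ℚ(c, e^c) ≤ trdegP + 1`, `trdegP` finite
    have h1 := htower.le.trans habs
    have h2 := ((add_comm _ _).le.trans h1).trans (add_comm _ _).le
    have h3 := (Cardinal.add_le_add_iff_of_lt_aleph0 hfin).1 h2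
    simpa using h3

/-- **CLEARANCE `3` FROM A CURVE-CLOSED SCHANUEL SUBSPACE** (no lower-rank hypothesis). -/
theorem finrank_inf_add_three_le_of_isCurveClosed {K : Submodule ℚ ℂ} (hK : IsCurveClosed K) (hS : SchanuelOn K)
    {n : ℕ} {y : Fin n → ℂ} (hy : LinearIndependent ℚ y)
    (hdef : Algebra.trdeg ℚ ↥(IntermediateField.adjoin ℚ (range y ∪ range (cexp ∘ y))) < (n : Cardinal))
    (hyK : ¬ ∀ t, y t ∈ K) : Module.finrank ℚ ↥(Submodule.span ℚ (range y) ⊓ K) + 3 ≤ n := by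
  have h := finrank_inf_add_le_of_absorbsBlocks le_rfl hS (absorbsBlocks_one_of_isCurveClosed hK) hy hdef hyK
  omega

/-- For 1J's curve hull `𝓚` (curve-closed by construction): Schanuel on `𝓚` alone puts every counterexample not inside `𝓚` at
clearance `3` from `𝓚`. -/
theorem finrank_inf_curveHull_add_three_le (hS : SchanuelOn curveHull) {n : ℕ} {y : Fin n → ℂ}
    (hy : LinearIndependent ℚ y)
    (hdef : Algebra.trdeg ℚ ↥(IntermediateField.adjoin ℚ (range y ∪ range (cexp ∘ y))) < (n : Cardinal))
    (hyK : ¬ ∀ t, y t ∈ curveHull) : Module.finrank ℚ ↥(Submodule.span ℚ (range y) ⊓ curveHull) + 3 ≤ n :=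
  finrank_inf_add_three_le_of_isCurveClosed isCurveClosed_curveHull hS hy hdef hyK

/-- The same from route 1H's structural binders `ProductSchanuel` (28261) and `RelTowerSchanuel` (28933), with the tower-hull
hypothesis of `BridgeTransverse` (30564) in its inline form — this is `RootDecomp1HClearance.finrank_inf_curveHull_add_three_le'`
WITHOUT its lower-rank hypothesis. -/
theorem finrank_inf_curveHull_add_three_le_of_structural (hPS : ProductSchanuel) (hRT : RelTowerSchanuel) {n : ℕ}
    {y : Fin n → ℂ} (hy : LinearIndependent ℚ y)
    (hdef : Algebra.trdeg ℚ ↥(IntermediateField.adjoin ℚ (range y ∪ range (cexp ∘ y))) < (n : Cardinal))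
    (hnh : ¬ ∃ (N : ℕ) (b : Fin N → ℂ), LinearIndependent ℚ b ∧
      (∀ (k : ℕ) (hk : k ≤ N), Algebra.trdeg ℚ ↥(IntermediateField.adjoin ℚ (Set.range (b ∘ Fin.castLE hk) ∪
        Set.range (Complex.exp ∘ (b ∘ Fin.castLE hk)))) ≤ (k : Cardinal)) ∧
      ∀ j, y j ∈ Submodule.span ℚ (Set.range b)) :
    Module.finrank ℚ ↥(Submodule.span ℚ (range y) ⊓ curveHull) + 3 ≤ n :=
  finrank_inf_curveHull_add_three_le (schanuelOn_curveHull_of_structural hPS hRT) hy hdef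
    fun hall => hnh ((inTowerHull_iff_mem_curveHull hPS hRT y).2 hall)

/-! ## 5. `j = 2`: the typed target offered to route 1J's `K₂` -/

/-- **CLEARANCE `4`** from any `2`-absorbing Schanuel subspace — the form in which route 1J's hull `K₂` (once certified
`AbsorbsBlocks 2 K₂`, with Schanuel on `K₂` = its pieces `G₂ ∧ K₃`) confines the remaining counterexamples. -/
theorem finrank_inf_add_four_le_of_absorbsBlocks_two {K : Submodule ℚ ℂ} (hS : SchanuelOn K) (hK : AbsorbsBlocks 2 K)
    {n : ℕ} {y : Fin n → ℂ} (hy : LinearIndependent ℚ y)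
    (hdef : Algebra.trdeg ℚ ↥(IntermediateField.adjoin ℚ (range y ∪ range (cexp ∘ y))) < (n : Cardinal))
    (hyK : ¬ ∀ t, y t ∈ K) : Module.finrank ℚ ↥(Submodule.span ℚ (range y) ⊓ K) + 4 ≤ n := by
  have h := finrank_inf_add_le_of_absorbsBlocks (by norm_num) hS hK hy hdef hyK
  omega

/-- … and Schanuel in ranks `≤ 3` outright from Schanuel on a `2`-absorbing subspace. -/
theorem schanuelRank_le_three_of_absorbsBlocks_two {K : Submodule ℚ ℂ} (hS : SchanuelOn K) (hK : AbsorbsBlocks 2 K)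
    {n : ℕ} (hn : n ≤ 3) : SchanuelRank n :=
  schanuelRank_of_absorbsBlocks (by norm_num) hS hK hn

end Summit.Schanuel.Schanuel.Theorems.RootDecomp1HBlockClearance
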